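import Summits.HubbardSuperconductivity.HubbardSuperconductivity.Theorems.AnisotropyChordDressHalfFilledFirstOrderVanishes
import Literature.MathematicalPhysics.QuantumLattice.FinDimSpectrumSectorGibbsLimit
import Literature.MathematicalPhysics.QuantumLattice.TorusPairSusceptibility
import Literature.MathematicalPhysics.QuantumLattice.FreeFermiGasNoPairFieldLRO
import Literature.MathematicalPhysics.QuantumLattice.HubbardWave0LiebProofs
import Literature.MathematicalPhysics.QuantumLattice.RayleighBottom
import Mathlib.Analysis.CStarAlgebra.ContinuousFunctionalCalculus.Commute
import HarnessLib

/-!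
# Crux `DressHalfFilled` (stmt-HubbardSuperconductivity-8148, routes `AnisotropyChord` / `LevyLogBootstrap`), stub 3
# `stub_dressHalfFilled`: KATO'S SECOND-ORDER VARIATIONAL UPPER BOUND for the quarter-doped sector energy of the
# checkerboard Hubbard torus `H_in + t' T`

Helper file (`--supports stmt-HubbardSuperconductivity-8148`). Notation: `H₀ = H_in = hamiltonian G_intra 1 U`,
`T = hamiltonian G_inter 1 0`, `Φ = TorusPlaquette.dictionaryMap M U` (side `L = 2M`), `S = reducedResolvent H₀ E₀` (Kato's
reduced resolvent, `Literature/…/ClusterPairBosonCouplings`), `P = eigenProj H₀ E₀`, `K = szSector N 0` an electron sector,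
`E_K(X) = X.minEnergyOn K` the sector energy.

The line's Schrieffer–Wolff expansion reads `H_L(t', U) = H₀ + t' T` with `P T P = 0` (`…FirstOrderVanishes`) and second-order
kernel `Φᴴ T S T Φ = −(2J·XXZ(Δ_eff) + k)` (dictionary clause (d)). This file proves the exact finite-dimensional UPPER half of
Kato's reduction for the sector ground energy, by the first-order-dressed trial state `a − t' S T a` (Kato 1966 II-§2.3, the case
`P T⁽¹⁾ P = 0`; Rayleigh–Schrödinger):

* `minEnergyOn_le_rayleigh_div'` — the variational principle with an unnormalised trial vector;
* `minEnergyOn_le_second_order_trial` — ABSTRACT second-order trial bound: `H₀, T` Hermitian, `a, b ∈ K`, `H₀ a = E₀ a`, `‖a‖ = 1`,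
  `⟨a, b⟩ = 0`, `⟨a, T a⟩ = 0`, `0 ≤ t ≤ 1` ⇒
  `E_K(H₀ + tT) ≤ E₀ + t²·q + t³·(|γ| + |q|·‖b‖²)`, `q = Re⟨b,(H₀−E₀)b⟩ + 2Re⟨a,Tb⟩`, `γ = Re⟨b,Tb⟩`;
* `minEnergyOn_le_second_order_kato` — with Kato's choice `b = −S T a` (needs `S T a ∈ K`): `q = −Re⟨Ta, S Ta⟩`, i.e.
  **`E_K(H₀ + tT) ≤ E₀ − t²·Re⟨a, T S T a⟩ + C(a)·t³`** (`S a = 0`, `P S = 0`, `(H₀ − E₀) S = 1 − P`);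
* `reducedResolvent_mulVec_mem_szSector` — `S` of a Hubbard Hamiltonian preserves every `(N, S^z)` sector (`S` is a functional
  calculus of `H₀`, which conserves `N` and `S^z`);
* `plaquette_sectorEnergy_le_second_order` — THE INSTANCE: for `M ≥ 2`, `N_b ≤ M²`, every unit spin vector `φ` of the boson
  sector `S^z_tot = N_b − M²/2` and `t' ∈ [0, 1]`:
  `E_{(L² − 2N_b, 0)}(H_in + t' T) ≤ E₀(N_b) − t'²·Re⟨Φφ, T S(E₀) T Φφ⟩ + C·t'³`
  with `E₀(N_b) = (M² − N_b)E(0h) + N_b E(2h)`; by clause (d) the `t'²`-coefficient is `⟨φ, (2J·XXZ(Δ_eff) + k(N_b)) φ⟩`, so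
  minimising over `φ`: `E ≤ E₀ + t'²(2J·e_XXZ + k) + O_L(t'³)` — the effective XXZ gas at second order, as an inequality.

HONEST LABEL: finite-dimensional, fixed-`L` bookkeeping (the constant `C` depends on `L` through `‖S T Φφ‖`); the matching
lower bound, the ground-state concentration and above all the uniform-in-`L` survival of the order (the content of stub 3)
are NOT addressed; no crux and no summit statement is proved. Sources: T. Kato, *Perturbation Theory for Linear Operators*
(1966) II-§2.3, I-§5.3 (5.28)–(5.29) [Kato1966]; W.-F. Tsai, S. A. Kivelson, PRB 73 (2006) 214510, App. A [TsaiKivelson2006];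
H. Tasaki (2020) §2.1 (variational principle). No definition and no named fact is introduced; sorry-free.
-/

noncomputable section

-- `dupNamespace`: the summit and the problem are both named `HubbardSuperconductivity` (layout D-0022)
set_option linter.dupNamespace false

namespace Summit.HubbardSuperconductivity.HubbardSuperconductivity.Theorems.AnisotropyChord.DressSecond

open Matrix Literature.MathematicalPhysics.QuantumLattice Literature.Probability.LatticeModels
open Literature.MathematicalPhysics.QuantumLattice.TorusPlaquette
open scoped ComplexOrder

/-! ### Abstract second-order trial bounds -/

section Abstract

variable {m : Type*} [Fintype m] [DecidableEq m]

omit [DecidableEq m] in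
/-- A self inner product is real: `⟨v, v⟩ = Re⟨v, v⟩`. [folklore] -/
theorem star_dotProduct_self_eq_re (v : m → ℂ) : star v ⬝ᵥ v = (((star v ⬝ᵥ v).re : ℝ) : ℂ) := by
  obtain ⟨-, him⟩ := Complex.nonneg_iff.mp (dotProduct_star_self_nonneg v)
  apply Complex.ext
  · simp
  · simp [← him]

/-- **Variational principle with an unnormalised trial vector**: `E_K(H) ≤ Re⟨v, Hv⟩ / ‖v‖²` for `v ∈ K` with
`‖v‖² > 0`. Tasaki (2020) §2.1 (2.1.6). (Adapted from the private `minEnergyOn_le_rayleigh_div_nogap` of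
`Literature/…/HardCoreBosonBECPhaseNoGap`.) [folklore] -/
theorem minEnergyOn_le_rayleigh_div' {H : Matrix m m ℂ} (hH : H.IsHermitian) (K : Submodule ℂ (m → ℂ))
    {v : m → ℂ} (hv : v ∈ K) (hv0 : 0 < (star v ⬝ᵥ v).re) :
    H.minEnergyOn K ≤ (star v ⬝ᵥ (H *ᵥ v)).re / (star v ⬝ᵥ v).re := by
  set r : ℝ := (star v ⬝ᵥ v).re with hr
  have hvv : star v ⬝ᵥ v = (r : ℂ) := star_dotProduct_self_eq_re v
  set c : ℝ := (Real.sqrt r)⁻¹ with hc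
  have hc2 : c ^ 2 * r = 1 := by
    rw [hc, inv_pow, Real.sq_sqrt hv0.le, inv_mul_cancel₀ hv0.ne']
  set ψ : m → ℂ := (c : ℂ) • v with hψ
  have hψK : ψ ∈ K := K.smul_mem _ hv
  have hψ1 : star ψ ⬝ᵥ ψ = 1 := by
    rw [hψ, star_smul, smul_dotProduct, dotProduct_smul, hvv, Complex.star_def, Complex.conj_ofReal, smul_eq_mul,
      smul_eq_mul]
    exact_mod_cast (by rw [← hc2]; ring : (c : ℝ) * (c * r) = 1)
  have h := minEnergyOn_le_rayleigh_of_mem hH K hψK hψ1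
  rw [hψ, mulVec_smul, star_smul, smul_dotProduct, dotProduct_smul, Complex.star_def, Complex.conj_ofReal,
    smul_eq_mul, smul_eq_mul, ← mul_assoc, ← Complex.ofReal_mul, Complex.re_ofReal_mul] at h
  rw [le_div_iff₀ hv0]
  calc H.minEnergyOn K * r ≤ c * c * (star v ⬝ᵥ H *ᵥ v).re * r := mul_le_mul_of_nonneg_right h hv0.le
    _ = (star v ⬝ᵥ H *ᵥ v).re * (c ^ 2 * r) := by ring
    _ = (star v ⬝ᵥ H *ᵥ v).re := by rw [hc2, mul_one]

/-- **Abstract second-order trial bound.** `H₀, T` Hermitian, `K` a subspace containing `a` and `b`, `H₀ a = E₀ a`,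
`‖a‖ = 1`, `⟨a, b⟩ = 0`, `⟨a, T a⟩ = 0` (no first-order shift). Then for `0 ≤ t ≤ 1`, with
`q = Re⟨b, H₀ b⟩ − E₀‖b‖² + 2Re⟨a, T b⟩` and `γ = Re⟨b, T b⟩`:
`E_K(H₀ + tT) ≤ E₀ + t²·q + t³·(|γ| + |q|·‖b‖²)` — the Rayleigh quotient of `a + t b`. Kato (1966) II-§2.3;
Tasaki (2020) §2.1. [folklore] -/
theorem minEnergyOn_le_second_order_trial {H₀ T : Matrix m m ℂ} (hH₀ : H₀.IsHermitian) (hT : T.IsHermitian)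
    (K : Submodule ℂ (m → ℂ)) {a b : m → ℂ} (ha : a ∈ K) (hb : b ∈ K) {E₀ : ℝ}
    (hHa : H₀ *ᵥ a = (E₀ : ℂ) • a) (ha1 : star a ⬝ᵥ a = 1) (hab : star a ⬝ᵥ b = 0)
    (haTa : star a ⬝ᵥ (T *ᵥ a) = 0) {t : ℝ} (ht0 : 0 ≤ t) (ht1 : t ≤ 1) :
    (H₀ + (t : ℂ) • T).minEnergyOn K ≤
      E₀ + t ^ 2 * ((star b ⬝ᵥ (H₀ *ᵥ b)).re - E₀ * (star b ⬝ᵥ b).re + 2 * (star a ⬝ᵥ (T *ᵥ b)).re) +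
        t ^ 3 * (|(star b ⬝ᵥ (T *ᵥ b)).re| +
          |(star b ⬝ᵥ (H₀ *ᵥ b)).re - E₀ * (star b ⬝ᵥ b).re + 2 * (star a ⬝ᵥ (T *ᵥ b)).re| * (star b ⬝ᵥ b).re) := by
  -- names
  set β : ℝ := (star b ⬝ᵥ b).re with hβ
  set γ : ℝ := (star b ⬝ᵥ (T *ᵥ b)).re with hγ
  set η : ℝ := (star a ⬝ᵥ (T *ᵥ b)).re with hη
  set θ : ℝ := (star b ⬝ᵥ (H₀ *ᵥ b)).re with hθ
  have hβ0 : 0 ≤ β := (Complex.nonneg_iff.mp (dotProduct_star_self_nonneg b)).1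
  have hHerm : (H₀ + (t : ℂ) • T).IsHermitian := by
    have h2 : ((t : ℂ) • T).IsHermitian := by
      rw [Matrix.IsHermitian, conjTranspose_smul, hT.eq, Complex.star_def, Complex.conj_ofReal]
    exact hH₀.add h2
  -- the trial vector
  set v : m → ℂ := a + (t : ℂ) • b with hv
  have hvK : v ∈ K := K.add_mem ha (K.smul_mem _ hb)
  -- cross inner products
  have hba : star b ⬝ᵥ a = 0 := by rw [star_dotProduct, hab, star_zero]
  have haHb : star a ⬝ᵥ (H₀ *ᵥ b) = 0 := by
    rw [RayleighBottom.star_dotProduct_mulVec_eq, hH₀.eq, hHa, star_smul, smul_dotProduct, hab, smul_zero]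
  have hbHa : star b ⬝ᵥ (H₀ *ᵥ a) = 0 := by
    rw [hHa, dotProduct_smul, hba, smul_zero]
  have haHa : star a ⬝ᵥ (H₀ *ᵥ a) = (E₀ : ℂ) := by
    rw [hHa, dotProduct_smul, ha1, smul_eq_mul, mul_one]
  have hbTa : (star b ⬝ᵥ (T *ᵥ a)).re = η := by
    rw [RayleighBottom.star_dotProduct_mulVec_eq, hT.eq, star_dotProduct, Complex.star_def, Complex.conj_re]
  -- ‖v‖² = 1 + t² β
  have hvv : (star v ⬝ᵥ v).re = 1 + t ^ 2 * β := by
    rw [hv, star_add, star_smul, add_dotProduct, dotProduct_add, dotProduct_add, smul_dotProduct, smul_dotProduct,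
      dotProduct_smul, dotProduct_smul, ha1, hab, hba, Complex.star_def, Complex.conj_ofReal]
    simp only [smul_eq_mul, mul_zero, add_zero, zero_add, Complex.add_re, Complex.one_re]
    rw [← mul_assoc, ← Complex.ofReal_mul, Complex.re_ofReal_mul, hβ]
    ring
  have hvv0 : 0 < (star v ⬝ᵥ v).re := by rw [hvv]; positivity
  -- ⟨v, (H₀ + tT) v⟩ = E₀(1 + t²β) + t²(θ − E₀β + 2η) + t³γ
  have hnum : (star v ⬝ᵥ ((H₀ + (t : ℂ) • T) *ᵥ v)).re =
      E₀ * (1 + t ^ 2 * β) + t ^ 2 * (θ - E₀ * β + 2 * η) + t ^ 3 * γ := by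
    have e : star v ⬝ᵥ ((H₀ + (t : ℂ) • T) *ᵥ v) =
        (E₀ : ℂ) + (t : ℂ) * (t : ℂ) * (star b ⬝ᵥ (H₀ *ᵥ b)) +
          ((t : ℂ) * (star a ⬝ᵥ (T *ᵥ a)) + (t : ℂ) * (t : ℂ) * (star a ⬝ᵥ (T *ᵥ b)) +
            (t : ℂ) * (t : ℂ) * (star b ⬝ᵥ (T *ᵥ a)) + (t : ℂ) * (t : ℂ) * (t : ℂ) * (star b ⬝ᵥ (T *ᵥ b))) := by
      rw [hv, add_mulVec, smul_mulVec, mulVec_add, mulVec_add, mulVec_smul, mulVec_smul, star_add, star_smul,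
        Complex.star_def, Complex.conj_ofReal]
      simp only [add_dotProduct, dotProduct_add, smul_dotProduct, dotProduct_smul, smul_add, smul_eq_mul, haHa, haHb,
        hbHa, mul_zero, add_zero]
      ring
    rw [e, haTa, mul_zero, zero_add]
    simp only [← Complex.ofReal_mul, Complex.add_re, Complex.re_ofReal_mul, Complex.ofReal_re]
    rw [hbTa, ← hθ, ← hη, ← hγ]
    ring
  -- the Rayleigh quotient bound
  have hR := minEnergyOn_le_rayleigh_div' hHerm K hvK hvv0
  rw [hnum, hvv] at hR
  refine hR.trans ?_
  rw [div_le_iff₀ (by positivity : (0:ℝ) < 1 + t ^ 2 * β)]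
  -- elementary: t³γ ≤ t⁴βq + t³C(1 + t²β) with C = |γ| + |q|β
  set q : ℝ := θ - E₀ * β + 2 * η with hq
  have h43 : t ^ 4 ≤ t ^ 3 := by
    have := pow_le_pow_of_le_one ht0 ht1 (show 3 ≤ 4 by norm_num)
    simpa using this
  have hγa : γ ≤ |γ| := le_abs_self γ
  have hqa : -|q| ≤ q := neg_abs_le q
  have ht3 : 0 ≤ t ^ 3 := by positivity
  have ht5 : 0 ≤ t ^ 5 := by positivity
  have hqβ : 0 ≤ |q| * β := mul_nonneg (abs_nonneg q) hβ0
  nlinarith [mul_le_mul_of_nonneg_left hγa ht3, mul_nonneg (sub_nonneg.2 h43) hqβ,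
    mul_le_mul_of_nonneg_left hqa (by positivity : (0:ℝ) ≤ t ^ 4 * β),
    mul_nonneg ht5 (mul_nonneg hβ0 (add_nonneg (abs_nonneg γ) hqβ))]

/-- **Kato's first-order-dressed trial state.** `H₀, T` Hermitian; `S = reducedResolvent H₀ E₀`; `a ∈ K` a unit
`E₀`-eigenvector of `H₀` with no first-order shift `⟨a, T a⟩ = 0`; `S T a ∈ K`. Then for `0 ≤ t ≤ 1`:
`E_K(H₀ + tT) ≤ E₀ − t²·Re⟨Ta, S Ta⟩ + t³·(|Re⟨STa, T STa⟩| + |Re⟨Ta, S Ta⟩|·‖S T a‖²)`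
(trial vector `a − t S T a`; `S a = 0`, `P S = 0`, `(H₀ − E₀)S = 1 − P`). Kato (1966) II-§2.3 with `P T⁽¹⁾ P = 0`,
I-§5.3 (5.28)–(5.29). [folklore] -/
theorem minEnergyOn_le_second_order_kato {H₀ T : Matrix m m ℂ} (hH₀ : H₀.IsHermitian) (hT : T.IsHermitian)
    (K : Submodule ℂ (m → ℂ)) {a : m → ℂ} (ha : a ∈ K) {E₀ : ℝ}
    (hS : reducedResolvent H₀ E₀ *ᵥ (T *ᵥ a) ∈ K)
    (hHa : H₀ *ᵥ a = (E₀ : ℂ) • a) (ha1 : star a ⬝ᵥ a = 1) (haTa : star a ⬝ᵥ (T *ᵥ a) = 0)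
    {t : ℝ} (ht0 : 0 ≤ t) (ht1 : t ≤ 1) :
    (H₀ + (t : ℂ) • T).minEnergyOn K ≤
      E₀ - t ^ 2 * (star (T *ᵥ a) ⬝ᵥ (reducedResolvent H₀ E₀ *ᵥ (T *ᵥ a))).re +
        t ^ 3 * (|(star (reducedResolvent H₀ E₀ *ᵥ (T *ᵥ a)) ⬝ᵥ
              (T *ᵥ (reducedResolvent H₀ E₀ *ᵥ (T *ᵥ a)))).re| +
          |(star (T *ᵥ a) ⬝ᵥ (reducedResolvent H₀ E₀ *ᵥ (T *ᵥ a))).re| *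
            (star (reducedResolvent H₀ E₀ *ᵥ (T *ᵥ a)) ⬝ᵥ (reducedResolvent H₀ E₀ *ᵥ (T *ᵥ a))).re) := by
  set S := reducedResolvent H₀ E₀ with hSdef
  have hSh : S.IsHermitian := reducedResolvent_isHermitian H₀ E₀
  set w : m → ℂ := S *ᵥ (T *ᵥ a) with hw
  -- b = -w
  have hbK : -w ∈ K := K.neg_mem hS
  -- ⟨a, w⟩ = ⟨S a, T a⟩ = 0
  have hSa : S *ᵥ a = 0 := reducedResolvent_mulVec_of_eigenvector hH₀ hHa
  have haw : star a ⬝ᵥ w = 0 := by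
    rw [hw, RayleighBottom.star_dotProduct_mulVec_eq, hSh.eq, hSa, star_zero, zero_dotProduct]
  have hab : star a ⬝ᵥ (-w) = 0 := by rw [dotProduct_neg, haw, neg_zero]
  -- ⟨w, (H₀ − E₀) w⟩ = ⟨w, T a⟩ (`(H₀ − E₀)S = 1 − P`, `P S = 0`)
  have h1 : (H₀ - algebraMap ℝ (Matrix m m ℂ) E₀) *ᵥ w = T *ᵥ a - eigenProj H₀ E₀ *ᵥ (T *ᵥ a) := by
    rw [hw, mulVec_mulVec, sub_mul_reducedResolvent hH₀ E₀, sub_mulVec, one_mulVec]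
  have h2 : (algebraMap ℝ (Matrix m m ℂ) E₀) *ᵥ w = (E₀ : ℂ) • w := by
    rw [IsScalarTower.algebraMap_apply ℝ ℂ (Matrix m m ℂ), Algebra.algebraMap_eq_smul_one, smul_mulVec, one_mulVec]
    rfl
  have hHw : H₀ *ᵥ w = (E₀ : ℂ) • w + (T *ᵥ a - eigenProj H₀ E₀ *ᵥ (T *ᵥ a)) := by
    rw [← h1, sub_mulVec, h2]
    abel
  have hPw : star w ⬝ᵥ (eigenProj H₀ E₀ *ᵥ (T *ᵥ a)) = 0 := by
    rw [RayleighBottom.star_dotProduct_mulVec_eq, (eigenProj_isHermitian H₀ E₀).eq, hw, mulVec_mulVec,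
      eigenProj_mul_reducedResolvent, zero_mulVec, star_zero, zero_dotProduct]
  have hwHw : (star w ⬝ᵥ (H₀ *ᵥ w)).re - E₀ * (star w ⬝ᵥ w).re = (star w ⬝ᵥ (T *ᵥ a)).re := by
    rw [hHw, dotProduct_add, dotProduct_sub, hPw, sub_zero, dotProduct_smul, Complex.add_re, smul_eq_mul,
      Complex.re_ofReal_mul]
    ring
  -- ⟨w, T a⟩ = conj⟨T a, w⟩, ⟨a, T w⟩ = ⟨T a, w⟩
  have hwTa : (star w ⬝ᵥ (T *ᵥ a)).re = (star (T *ᵥ a) ⬝ᵥ w).re := by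
    rw [star_dotProduct, Complex.star_def, Complex.conj_re]
  have haTw : star a ⬝ᵥ (T *ᵥ w) = star (T *ᵥ a) ⬝ᵥ w := by rw [RayleighBottom.star_dotProduct_mulVec_eq, hT.eq]
  -- apply the abstract bound with b = -w
  have h := minEnergyOn_le_second_order_trial hH₀ hT K ha hbK hHa ha1 hab haTa ht0 ht1
  -- rewrite the coefficients
  have hq : (star (-w) ⬝ᵥ (H₀ *ᵥ (-w))).re - E₀ * (star (-w) ⬝ᵥ (-w)).re + 2 * (star a ⬝ᵥ (T *ᵥ (-w))).re =
      -(star (T *ᵥ a) ⬝ᵥ w).re := by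
    rw [star_neg, mulVec_neg, neg_dotProduct, dotProduct_neg, neg_neg, neg_dotProduct, dotProduct_neg, neg_neg,
      mulVec_neg, dotProduct_neg, Complex.neg_re, hwHw, hwTa, haTw]
    ring
  have hγ : (star (-w) ⬝ᵥ (T *ᵥ (-w))).re = (star w ⬝ᵥ (T *ᵥ w)).re := by
    rw [star_neg, mulVec_neg, neg_dotProduct, dotProduct_neg, neg_neg]
  have hβ : (star (-w) ⬝ᵥ (-w)).re = (star w ⬝ᵥ w).re := by
    rw [star_neg, neg_dotProduct, dotProduct_neg, neg_neg]
  rw [hq, hγ, hβ, abs_neg] at h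
  linarith

end Abstract

/-! ### The reduced resolvent of a Hubbard Hamiltonian preserves the `(N, S^z)` sectors -/

section Sector

variable {Λ : Type*} [LinearOrder Λ] [Fintype Λ]

/-- `S = reducedResolvent (hamiltonian G t U) E` commutes with `N` and `S^z` (a real functional calculus of a matrix
commuting with them), hence maps every joint sector `szSector N M` into itself. (The `DecidableEq` instance entering
`reducedResolvent` is taken by unification, `{hdec}`, so that the lemma applies verbatim in contexts whose synthesized
instance path differs.) [folklore] -/
theorem reducedResolvent_mulVec_mem_szSector {hdec : DecidableEq (Finset (Orb Λ))} (G : SimpleGraph Λ)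
    [DecidableRel G.Adj] (t U E : ℝ) {N : ℕ} {Mz : ℝ} {v : Fock (Orb Λ)} (hv : v ∈ szSector N Mz) :
    reducedResolvent (hamiltonian G t U) E *ᵥ v ∈ szSector N Mz := by
  obtain ⟨-, hN, hS⟩ := hamiltonian_isHermitian_and_commute_holds G t U
  have hN' : Commute (reducedResolvent (hamiltonian G t U) E) totalNumber := by
    rw [reducedResolvent]; exact hN.cfc_real _
  have hS' : Commute (reducedResolvent (hamiltonian G t U) E) HubbardWave0.spinZ := by
    rw [reducedResolvent]; exact hS.cfc_real _
  exact mulVec_mem_szSector_of_commute hN' hS' hv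

/-- A Hubbard Hamiltonian maps every joint sector into itself. [folklore] -/
theorem hamiltonian_mulVec_mem_szSector (G : SimpleGraph Λ) [DecidableRel G.Adj] (t U : ℝ) {N : ℕ} {Mz : ℝ}
    {v : Fock (Orb Λ)} (hv : v ∈ szSector N Mz) :
    hamiltonian G t U *ᵥ v ∈ szSector N Mz := by
  obtain ⟨-, hN, hS⟩ := hamiltonian_isHermitian_and_commute_holds G t U
  exact mulVec_mem_szSector_of_commute hN hS hv

end Sector

/-! ### The instance: the checkerboard Hubbard torus on the dictionary -/

section Plaquette

variable {M : ℕ} [NeZero M]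

set_option linter.style.longLine false in
/-- **Second-order upper bound for the sector energy of the checkerboard Hubbard torus on the plaquette ground space.**
For `M ≥ 2`, `N_b ≤ M²`, a unit spin vector `φ` of the boson sector `S^z_tot = N_b − M²/2` of the `M × M` torus, and
`t' ∈ [0, 1]`: with `a = Φφ` (`Φ = dictionaryMap M U`), `H₀ = H_in`, `T = hamiltonian G_inter 1 0`,
`E₀ = (M² − N_b)E(0h) + N_b E(2h)`, `S = reducedResolvent H₀ E₀`, `w = S T a`:
`E_{(L² − 2N_b, 0)}(H₀ + t' T) ≤ E₀ − t'²·Re⟨T a, w⟩ + t'³·(|Re⟨w, T w⟩| + |Re⟨T a, w⟩|·‖w‖²)`.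
Ingredients: `Φφ ∈` the electron sector and `H_in Φφ = E₀ Φφ` (dictionary (b)), `⟨Φφ, T Φφ⟩ = 0`
(`…FirstOrderVanishes`), `S T Φφ ∈` the sector (`reducedResolvent_mulVec_mem_szSector`). By clause (d) of the dictionary the
`t'²`-coefficient `−Re⟨Ta, S Ta⟩ = −Re⟨a, T S T a⟩` equals `⟨φ, (2J·XXZ(Δ_eff) + k(N_b)) φ⟩`. Kato (1966) II-§2.3;
Tsai–Kivelson (2006) App. A. [folklore] -/
theorem plaquette_sectorEnergy_le_second_order (hM : 2 ≤ M) (U : ℝ) {Nb : ℕ} (hNb : Nb ≤ M ^ 2)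
    {φ : TensorIndex (TorusSite 2 M) 2 → ℂ}
    (hφ : φ ∈ spinZSector (Λ := TorusSite 2 M) 1 ((Nb : ℝ) - (M : ℝ) ^ 2 / 2)) (hφ1 : star φ ⬝ᵥ φ = 1)
    {t' : ℝ} (ht0 : 0 ≤ t') (ht1 : t' ≤ 1) :
    (hamiltonian (fermionTorusGraph 2 (2 * M) \
          SimpleGraph.comap (fun x : FermionTorus 2 (2 * M) => fun i : Fin 2 => ((ofLex x) i : ℕ) / 2) ⊤) 1 U +
        (t' : ℂ) • hamiltonian (fermionTorusGraph 2 (2 * M) ⊓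
          SimpleGraph.comap (fun x : FermionTorus 2 (2 * M) => fun i : Fin 2 => ((ofLex x) i : ℕ) / 2) ⊤) 1 0).minEnergyOn
        (szSector (Λ := FermionTorus 2 (2 * M)) ((2 * M) ^ 2 - 2 * Nb) 0) ≤
      (((M : ℝ) ^ 2 - Nb) * plaquetteEnergy U 0 + Nb * plaquetteEnergy U 2) -
        t' ^ 2 * (star (hamiltonian (fermionTorusGraph 2 (2 * M) ⊓
            SimpleGraph.comap (fun x : FermionTorus 2 (2 * M) => fun i : Fin 2 => ((ofLex x) i : ℕ) / 2) ⊤) 1 0 *ᵥ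
              (dictionaryMap M U *ᵥ φ)) ⬝ᵥ
          (reducedResolvent (hamiltonian (fermionTorusGraph 2 (2 * M) \
              SimpleGraph.comap (fun x : FermionTorus 2 (2 * M) => fun i : Fin 2 => ((ofLex x) i : ℕ) / 2) ⊤) 1 U)
              (((M : ℝ) ^ 2 - Nb) * plaquetteEnergy U 0 + Nb * plaquetteEnergy U 2) *ᵥ
            (hamiltonian (fermionTorusGraph 2 (2 * M) ⊓
              SimpleGraph.comap (fun x : FermionTorus 2 (2 * M) => fun i : Fin 2 => ((ofLex x) i : ℕ) / 2) ⊤) 1 0 *ᵥ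
                (dictionaryMap M U *ᵥ φ)))).re +
        t' ^ 3 * (|(star (reducedResolvent (hamiltonian (fermionTorusGraph 2 (2 * M) \
              SimpleGraph.comap (fun x : FermionTorus 2 (2 * M) => fun i : Fin 2 => ((ofLex x) i : ℕ) / 2) ⊤) 1 U)
              (((M : ℝ) ^ 2 - Nb) * plaquetteEnergy U 0 + Nb * plaquetteEnergy U 2) *ᵥ
            (hamiltonian (fermionTorusGraph 2 (2 * M) ⊓
              SimpleGraph.comap (fun x : FermionTorus 2 (2 * M) => fun i : Fin 2 => ((ofLex x) i : ℕ) / 2) ⊤) 1 0 *ᵥ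
                (dictionaryMap M U *ᵥ φ))) ⬝ᵥ
            (hamiltonian (fermionTorusGraph 2 (2 * M) ⊓
              SimpleGraph.comap (fun x : FermionTorus 2 (2 * M) => fun i : Fin 2 => ((ofLex x) i : ℕ) / 2) ⊤) 1 0 *ᵥ
              (reducedResolvent (hamiltonian (fermionTorusGraph 2 (2 * M) \
                SimpleGraph.comap (fun x : FermionTorus 2 (2 * M) => fun i : Fin 2 => ((ofLex x) i : ℕ) / 2) ⊤) 1 U)
                (((M : ℝ) ^ 2 - Nb) * plaquetteEnergy U 0 + Nb * plaquetteEnergy U 2) *ᵥ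
              (hamiltonian (fermionTorusGraph 2 (2 * M) ⊓
                SimpleGraph.comap (fun x : FermionTorus 2 (2 * M) => fun i : Fin 2 => ((ofLex x) i : ℕ) / 2) ⊤) 1 0 *ᵥ
                  (dictionaryMap M U *ᵥ φ))))).re| +
          |(star (hamiltonian (fermionTorusGraph 2 (2 * M) ⊓
              SimpleGraph.comap (fun x : FermionTorus 2 (2 * M) => fun i : Fin 2 => ((ofLex x) i : ℕ) / 2) ⊤) 1 0 *ᵥ
                (dictionaryMap M U *ᵥ φ)) ⬝ᵥ
            (reducedResolvent (hamiltonian (fermionTorusGraph 2 (2 * M) \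
                SimpleGraph.comap (fun x : FermionTorus 2 (2 * M) => fun i : Fin 2 => ((ofLex x) i : ℕ) / 2) ⊤) 1 U)
                (((M : ℝ) ^ 2 - Nb) * plaquetteEnergy U 0 + Nb * plaquetteEnergy U 2) *ᵥ
              (hamiltonian (fermionTorusGraph 2 (2 * M) ⊓
                SimpleGraph.comap (fun x : FermionTorus 2 (2 * M) => fun i : Fin 2 => ((ofLex x) i : ℕ) / 2) ⊤) 1 0 *ᵥ
                  (dictionaryMap M U *ᵥ φ)))).re| *
            (star (reducedResolvent (hamiltonian (fermionTorusGraph 2 (2 * M) \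
                SimpleGraph.comap (fun x : FermionTorus 2 (2 * M) => fun i : Fin 2 => ((ofLex x) i : ℕ) / 2) ⊤) 1 U)
                (((M : ℝ) ^ 2 - Nb) * plaquetteEnergy U 0 + Nb * plaquetteEnergy U 2) *ᵥ
              (hamiltonian (fermionTorusGraph 2 (2 * M) ⊓
                SimpleGraph.comap (fun x : FermionTorus 2 (2 * M) => fun i : Fin 2 => ((ofLex x) i : ℕ) / 2) ⊤) 1 0 *ᵥ
                  (dictionaryMap M U *ᵥ φ))) ⬝ᵥ
              (reducedResolvent (hamiltonian (fermionTorusGraph 2 (2 * M) \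
                SimpleGraph.comap (fun x : FermionTorus 2 (2 * M) => fun i : Fin 2 => ((ofLex x) i : ℕ) / 2) ⊤) 1 U)
                (((M : ℝ) ^ 2 - Nb) * plaquetteEnergy U 0 + Nb * plaquetteEnergy U 2) *ᵥ
              (hamiltonian (fermionTorusGraph 2 (2 * M) ⊓
                SimpleGraph.comap (fun x : FermionTorus 2 (2 * M) => fun i : Fin 2 => ((ofLex x) i : ℕ) / 2) ⊤) 1 0 *ᵥ
                  (dictionaryMap M U *ᵥ φ)))).re) := by
  -- NB: no local abbreviations for the graphs — every `hamiltonian G t U` below must carry the instance term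
  -- synthesized for the literal graph expression (a `set` alias re-synthesizes `DecidableRel G.Adj` and the final
  -- unification then times out).
  set a := dictionaryMap M U *ᵥ φ with ha
  have hH₀ := (hamiltonian_isHermitian_and_commute_holds (fermionTorusGraph 2 (2 * M) \
    SimpleGraph.comap (fun x : FermionTorus 2 (2 * M) => fun i : Fin 2 => ((ofLex x) i : ℕ) / 2) ⊤) 1 U).1
  have hT := (hamiltonian_isHermitian_and_commute_holds (fermionTorusGraph 2 (2 * M) ⊓
    SimpleGraph.comap (fun x : FermionTorus 2 (2 * M) => fun i : Fin 2 => ((ofLex x) i : ℕ) / 2) ⊤) 1 0).1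
  have haK := dictionaryMap_mulVec_mem_szSector U hNb hφ
  have hHa := hamiltonian_intra_mulVec_dictionaryMap_mulVec hM U hNb hφ
  have ha1 : star a ⬝ᵥ a = 1 := by
    rw [ha, star_mulVec, ← dotProduct_mulVec, mulVec_mulVec, dictionaryMap_conjTranspose_mul_self, one_mulVec, hφ1]
  have haTa := DressFirst.star_dictionaryMap_mulVec_dotProduct_hamiltonian_inter hM U φ φ
  -- `hS` is stated in full so that `reducedResolvent` carries the instance synthesized HERE (as in the goal)
  have hS : reducedResolvent (hamiltonian (fermionTorusGraph 2 (2 * M) \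
        SimpleGraph.comap (fun x : FermionTorus 2 (2 * M) => fun i : Fin 2 => ((ofLex x) i : ℕ) / 2) ⊤) 1 U)
        (((M : ℝ) ^ 2 - Nb) * plaquetteEnergy U 0 + Nb * plaquetteEnergy U 2) *ᵥ
      (hamiltonian (fermionTorusGraph 2 (2 * M) ⊓
        SimpleGraph.comap (fun x : FermionTorus 2 (2 * M) => fun i : Fin 2 => ((ofLex x) i : ℕ) / 2) ⊤) 1 0 *ᵥ a) ∈
      szSector (Λ := FermionTorus 2 (2 * M)) ((2 * M) ^ 2 - 2 * Nb) 0 :=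
    reducedResolvent_mulVec_mem_szSector (fermionTorusGraph 2 (2 * M) \
        SimpleGraph.comap (fun x : FermionTorus 2 (2 * M) => fun i : Fin 2 => ((ofLex x) i : ℕ) / 2) ⊤) 1 U
      (((M : ℝ) ^ 2 - Nb) * plaquetteEnergy U 0 + Nb * plaquetteEnergy U 2)
      (hamiltonian_mulVec_mem_szSector (fermionTorusGraph 2 (2 * M) ⊓
        SimpleGraph.comap (fun x : FermionTorus 2 (2 * M) => fun i : Fin 2 => ((ofLex x) i : ℕ) / 2) ⊤) 1 0 haK)
  exact minEnergyOn_le_second_order_kato hH₀ hT _ haK hS hHa ha1 haTa ht0 ht1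

end Plaquette

end Summit.HubbardSuperconductivity.HubbardSuperconductivity.Theorems.AnisotropyChord.DressSecond

end
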